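import Literature.MathematicalPhysics.QuantumLattice.TorusSectorGibbsDensity
import Literature.MathematicalPhysics.QuantumLattice.FermionBoxSubadditivity
import Literature.MathematicalPhysics.QuantumLattice.TorusLimitOfMixturesLimsup
import Literature.MathematicalPhysics.QuantumLattice.FermionTorusTranslationSums
import Literature.Probability.LatticeModels.HalfOpenRectTiling
import HarnessLib

/-!
# The «entropy row» of the canonical sector Gibbs state of the `t–t'` Hubbard torus:
# `E_β/L² − (N_L/(βL²))·[⟨Γ G⟩ + log Tr e^{−G}] ≤ E₀/L² + seam`, box subadditivity + Klein, finite volume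

Topic `MathematicalPhysics/QuantumLattice`; assembles `TorusSectorGibbsDensity.lean` (the canonical Gibbs
density matrix `ρ_{L,β}`: even, translation invariant, `β(E_β − E₀) ≤ S(ρ_{L,β})`),
`FermionBoxSubadditivity.lean` (for even `ρ` on a region of `ℤ^d`: `S(ρ) ≤ Σ_v S_ρ(B_v) + seam·log 4`
over pairwise disjoint boxes, and Klein per box), the torus pull-back of `TorusMarkovPressureBound.lean`
(`torusBoxEmb`, `vonNeumannEntropy_fermionPartialTrace_torusBoxEmb`,
`vonNeumannEntropy_fermionPartialTrace_toTorusEmb_shiftSet`) and the tiling bookkeeping of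
`HalfOpenRectTiling.lean` (`rectTilingVecs m L`: `N_L = ∏_i ⌊L/m_i⌋` pairwise disjoint translates of the
rectangle `B = ∏_i [0,m_i)` inside `[0,L)²`).

* §1 `vonNeumannEntropy_fermionPartialTrace_le_re_trace_mul_add` — Klein / Gibbs variational bound for a
  marginal along ANY site embedding `φ`: `S(tr_φ ρ) ≤ Re tr(Γ_φ(G) ρ) + log Re Tr e^{−G}`.
* §2 `trace_sectorGibbsDensityTT'_mul_relabel_translate` (translation invariance of traces) and
  `trace_sectorGibbsDensityTT'_mul_fermionEmbed_toTorusEmb` — the expectation of a pulled-back local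
  observable in `ρ_{L,β}` IS the mixture torus average `Σ_i p_{L,i} torusAvgExpectAt L B G ψ_{L,i}` (the
  quantity whose limit along `Ls → ∞` defines `ω_B(G)` for a torus limit `ω`).
* §3 `torus_vonNeumannEntropy_le_card_mul_box` — for every even translation-invariant density matrix on the
  torus and every rectangle `B = halfOpenRect m` with `m_i ≤ L`:
  `S(ρ) ≤ N_L · S(ρ_B) + (L² − N_L·|B|)·log 4`, `ρ_B = tr_{B ↪ torus} ρ`.
* §4 `sectorGibbs_energy_sub_groundEnergy_le_box` — the finite-volume ENTROPY ROW of the canonical Gibbs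
  state (`0 ≤ n ≤ 2`, `β > 0`, Hermitian witness `G ∈ 𝔄_B`):
  `β (E_β(L) − E₀(L)) ≤ N_L · (Σ_i p_{L,i} Re torusAvgExpectAt L B G ψ_{L,i} + log Re Tr e^{−G}) + (L² − N_L|B|)·log 4`.

The thermodynamic-limit row for torus-limit states (`e_Φ(ω) − Re ω_B(G)/(β|B|) ≤ e(n) + log Tr e^{−G}/(β|B|)`)
follows in the sequel by `IsTorusLimitOfMixture.mul_meanEnergy_add_mul_re_expect_le_of_eventually_sectorGibbs`.
Everything is PROVED; no definition, no named fact.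

References: Araki–Moriya 2003 Thm. 3.8, §10 (SSA for even CAR states) [ArakiMoriya2003]; Israel 1979
Lemma II.3.1 (Gibbs variational principle), §I.3 eq. (26) [Israel1979]; Friedli–Velenik 2017 §3.2
[FriedliVelenik2017].
-/

noncomputable section

namespace Literature.MathematicalPhysics.QuantumLattice

open Matrix Finset HubbardWave0 Literature.Probability.LatticeModels ThermodynamicLimit
open Literature.InformationTheory.Entropy (vonNeumannEntropy)
open _root_.Filter
open scoped _root_.Topology ComplexOrder BigOperators

/-! ### §1 Klein's inequality for a marginal along an arbitrary site embedding -/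

section Klein

variable {Λ Λ' : Type*} [LinearOrder Λ] [Fintype Λ] [LinearOrder Λ'] [Fintype Λ']

/-- **Klein / Gibbs variational bound for a marginal**, torus form: for a density matrix `ρ` on `𝔄_{Λ'}`, a
site embedding `φ : Λ ↪ Λ'` and every Hermitian witness `G ∈ 𝔄_Λ`,
`S(tr_φ ρ) ≤ Re tr(Γ_φ(G)·ρ) + log Re Tr e^{−G}` (`vonNeumannEntropy_sub_mul_le_log_partitionFn` at `β = 1`
for the marginal, which is a density matrix, and the duality `tr(G·tr_φ ρ) = tr(Γ_φ G·ρ)`).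
[cite: Israel1979, Lemma II.3.1] -/
theorem vonNeumannEntropy_fermionPartialTrace_le_re_trace_mul_add (φ : Λ ↪ Λ')
    {ρ : Matrix (Finset (Orb Λ')) (Finset (Orb Λ')) ℂ} (hρ : ρ.PosSemidef) (htr : ρ.trace = 1)
    {G : Matrix (Finset (Orb Λ)) (Finset (Orb Λ)) ℂ} (hG : G.IsHermitian) :
    vonNeumannEntropy (fermionPartialTrace φ ρ) ≤ (fermionEmbed φ G * ρ).trace.re + Real.log (partitionFn 1 G).re := by
  have hρ' : (fermionPartialTrace φ ρ).PosSemidef := posSemidef_fermionPartialTrace _ hρ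
  have htr' : (fermionPartialTrace φ ρ).trace = 1 := by rw [trace_fermionPartialTrace, htr]
  have h := hG.vonNeumannEntropy_sub_mul_le_log_partitionFn 1 hρ' htr'
  rw [one_mul, Matrix.trace_mul_comm, trace_mul_fermionPartialTrace] at h
  linarith

end Klein

/-! ### §2 Traces against the canonical Gibbs density: translation invariance, torus averages -/

section Traces

variable (L : ℕ) [NeZero L]

/-- **Translation invariance of traces**: `tr(ρ_{L,β} · Γ(τ_v) X) = tr(ρ_{L,β} · X)` for every `X` and every
torus translation `v`. [cite: ArakiMoriya2003, §4.1 Def. 4.5] -/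
theorem trace_sectorGibbsDensityTT'_mul_relabel_translate (β t t' U n : ℝ) (v : TorusSite 2 L)
    (X : Matrix (Finset (Orb (FermionTorus 2 L))) (Finset (Orb (FermionTorus 2 L))) ℂ) :
    (sectorGibbsDensityTT' L β t t' U n * relabel (Orb.translate v) X).trace =
      (sectorGibbsDensityTT' L β t t' U n * X).trace := by
  set π : Equiv.Perm (Orb (FermionTorus 2 L)) := Orb.translate v with hπ
  have hinv : relabel π.symm (sectorGibbsDensityTT' L β t t' U n) = sectorGibbsDensityTT' L β t t' U n := by
    have h : π.symm = Orb.translate (-v) := by rw [hπ, Orb.translate_neg, Equiv.Perm.inv_def]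
    rw [h]
    exact relabel_translate_sectorGibbsDensityTT' L β t t' U n (-v)
  calc (sectorGibbsDensityTT' L β t t' U n * relabel π X).trace
      = (relabel π.symm (sectorGibbsDensityTT' L β t t' U n * relabel π X)).trace := (trace_relabel _ _).symm
    _ = (sectorGibbsDensityTT' L β t t' U n * X).trace := by rw [relabel_mul, relabel_symm_relabel, hinv]

/-- **The expectation of a pulled-back local observable is the mixture torus average**: for a region
`B ⊆ ℤ²` fitting into the torus and `G ∈ 𝔄_B`,
`tr(ρ_{L,β} · Γ_{B ↪ torus}(G)) = Σ_i p_{L,i}(β) · torusAvgExpectAt L B G ψ_{L,i}` (translation invariance: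
every translate `Γ(τ_v)ΓG` has the same trace, and their sum is `L²` times the torus average).
[cite: Israel1979, §I.3 eq. (26)] -/
theorem trace_sectorGibbsDensityTT'_mul_fermionEmbed_toTorusEmb (β t t' U n : ℝ) {B : Finset (Site 2)}
    (hB : Set.InjOn (Torus.proj (d := 2) L) ↑B) (G : FermionOp B) :
    (sectorGibbsDensityTT' L β t t' U n * fermionEmbed (PolySite.toTorusEmb L hB) G).trace =
      ∑ i, (sectorGibbsWeightTT' β t t' U n L i : ℂ) * torusAvgExpectAt L B G (sectorGibbsVectorTT' t t' U n L i) := by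
  set ρ := sectorGibbsDensityTT' L β t t' U n with hρ
  have hL : ((L : ℂ)) ^ 2 ≠ 0 := pow_ne_zero _ (Nat.cast_ne_zero.2 (NeZero.ne L))
  -- the sum over translates, computed in two ways
  have h1 : (ρ * ∑ v : TorusSite 2 L, relabel (Orb.translate v) (fermionEmbed (PolySite.toTorusEmb L hB) G)).trace =
      ((L : ℂ)) ^ 2 * (ρ * fermionEmbed (PolySite.toTorusEmb L hB) G).trace := by
    rw [Matrix.mul_sum, Matrix.trace_sum]
    simp_rw [hρ, trace_sectorGibbsDensityTT'_mul_relabel_translate]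
    rw [Finset.sum_const, Finset.card_univ, nsmul_eq_mul]
    congr 1
    have : Fintype.card (TorusSite 2 L) = L ^ 2 := by simp [ZMod.card, Fintype.card_fin]
    rw [this]
    push_cast
    rfl
  have h2 : (ρ * ∑ v : TorusSite 2 L, relabel (Orb.translate v) (fermionEmbed (PolySite.toTorusEmb L hB) G)).trace =
      ((L : ℂ)) ^ 2 * ∑ i, (sectorGibbsWeightTT' β t t' U n L i : ℂ) *
        torusAvgExpectAt L B G (sectorGibbsVectorTT' t t' U n L i) := by
    rw [hρ, trace_sectorGibbsDensityTT'_mul, Finset.mul_sum]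
    refine Finset.sum_congr rfl fun i _ => ?_
    rw [expect_sum_relabel_translate_fermionEmbed' L hB G]
    ring
  exact mul_left_cancel₀ hL (h1.symm.trans h2)

/-- Real form: `Re tr(Γ_{B ↪ torus}(G) · ρ_{L,β}) = Σ_i p_{L,i} Re torusAvgExpectAt L B G ψ_{L,i}`.
[cite: Israel1979, §I.3 eq. (26)] -/
theorem re_trace_fermionEmbed_toTorusEmb_mul_sectorGibbsDensityTT' (β t t' U n : ℝ) {B : Finset (Site 2)}
    (hB : Set.InjOn (Torus.proj (d := 2) L) ↑B) (G : FermionOp B) :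
    (fermionEmbed (PolySite.toTorusEmb L hB) G * sectorGibbsDensityTT' L β t t' U n).trace.re =
      ∑ i, sectorGibbsWeightTT' β t t' U n L i * (torusAvgExpectAt L B G (sectorGibbsVectorTT' t t' U n L i)).re := by
  rw [Matrix.trace_mul_comm, trace_sectorGibbsDensityTT'_mul_fermionEmbed_toTorusEmb, Complex.re_sum]
  refine Finset.sum_congr rfl fun i _ => ?_
  rw [Complex.re_ofReal_mul]

end Traces

/-! ### §3 Box subadditivity on the torus: `S(ρ) ≤ N_L · S(ρ_B) + (L² − N_L |B|)·log 4` -/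

section TorusBoxes

variable (L : ℕ) [NeZero L]

omit [NeZero L] in
/-- A rectangle with sides `≤ L` fits into the torus of side `L`. [cite: FriedliVelenik2017, §3.2] -/
theorem injOn_proj_halfOpenRect {m : Fin 2 → ℕ} (hmL : ∀ i, m i ≤ L) :
    Set.InjOn (Torus.proj (d := 2) L) ↑(halfOpenRect m) :=
  injOn_proj_of_subset_halfOpenBox' (halfOpenRect_subset_halfOpenBox hmL) le_rfl

/-- A window inside the cube, pulled back through the cube, is the window pulled back directly.
[folklore] -/
private theorem incl_trans_torusBoxEmb' {Λ : Finset (Site 2)} (hΛ : Λ ⊆ halfOpenBox 2 L) :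
    (PolySite.incl hΛ).trans (torusBoxEmb L) =
      PolySite.toTorusEmb L (injOn_proj_of_subset_halfOpenBox' hΛ le_rfl) :=
  DFunLike.ext _ _ fun _ => rfl

/-- **Box subadditivity on the torus.** For an even, translation-invariant density matrix `ρ` on the
fermionic torus of side `L` and a rectangle `B = ∏_i [0,m_i)` with `0 < m_i ≤ L`:
`S(ρ) ≤ N_L · S(tr_{B ↪ torus} ρ) + (L² − N_L·∏ m_i)·log 4`, `N_L = ∏_i ⌊L/m_i⌋` — pull the torus back to the
cube `[0,L)²`, apply `vonNeumannEntropy_le_sum_regionEntropy_add` to the `N_L` disjoint translates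
`B + v`, `v ∈ rectTilingVecs m L`, whose marginals all have the entropy of `ρ_B` by translation invariance.
[cite: ArakiMoriya2003, Theorem 3.8 and §10] -/
theorem torus_vonNeumannEntropy_le_card_mul_box
    {ρ : Matrix (Finset (Orb (FermionTorus 2 L))) (Finset (Orb (FermionTorus 2 L))) ℂ}
    (hρ : ρ.PosSemidef) (htr : ρ.trace = 1) (hev : parityAut ρ = ρ)
    (hTI : ∀ w : TorusSite 2 L, relabel (Orb.translate w) ρ = ρ)
    {m : Fin 2 → ℕ} (hmL : ∀ i, m i ≤ L) :
    vonNeumannEntropy ρ ≤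
      (#(rectTilingVecs m L) : ℝ) *
          vonNeumannEntropy (fermionPartialTrace (PolySite.toTorusEmb L (injOn_proj_halfOpenRect L hmL)) ρ) +
        ((L : ℝ) ^ 2 - (#(rectTilingVecs m L) : ℝ) * (∏ i, (m i : ℝ))) * Real.log 4 := by
  set ρ' : FermionOp (halfOpenBox 2 L) := fermionPartialTrace (torusBoxEmb L) ρ with hρ'
  have hρ'psd : ρ'.PosSemidef := posSemidef_fermionPartialTrace _ hρ
  have hρ'tr : ρ'.trace = 1 := by rw [hρ', trace_fermionPartialTrace, htr]
  have hρ'ev : parityAut ρ' = ρ' := parityAut_fermionPartialTrace_of_even _ hev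
  have hBsub : halfOpenRect m ⊆ halfOpenRect m := subset_refl _
  have hV : ∀ v ∈ rectTilingVecs m L, shiftSet v (halfOpenRect m) ⊆ halfOpenBox 2 L :=
    fun v hv => shiftSet_subset_halfOpenBox_of_mem_rectTilingVecs hv hBsub
  have hdisj : ∀ v ∈ rectTilingVecs m L, ∀ w ∈ rectTilingVecs m L, v ≠ w →
      Disjoint (shiftSet v (halfOpenRect m)) (shiftSet w (halfOpenRect m)) :=
    fun v hv w hw hne => disjoint_shiftSet_of_mem_rectTilingVecs hv hw hne hBsub
  have key := vonNeumannEntropy_le_sum_regionEntropy_add (rectTilingVecs m L)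
    (fun v => shiftSet v (halfOpenRect m)) hV hdisj hρ'psd hρ'tr hρ'ev
  -- every translate's marginal has the entropy of `ρ_B`
  have hregion : ∀ v ∈ rectTilingVecs m L, regionEntropy ρ' (shiftSet v (halfOpenRect m)) =
      vonNeumannEntropy (fermionPartialTrace (PolySite.toTorusEmb L (injOn_proj_halfOpenRect L hmL)) ρ) := by
    intro v hv
    rw [regionEntropy_of_subset ρ' (hV v hv), hρ', ← fermionPartialTrace_trans, incl_trans_torusBoxEmb' L (hV v hv)]
    exact vonNeumannEntropy_fermionPartialTrace_toTorusEmb_shiftSet L hρ.1 hTI v _ _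
  rw [Finset.sum_congr rfl hregion, Finset.sum_const, nsmul_eq_mul] at key
  have hcard : ∑ v ∈ rectTilingVecs m L, ((shiftSet v (halfOpenRect m)).card : ℝ) =
      (#(rectTilingVecs m L) : ℝ) * ∏ i, (m i : ℝ) := by
    simp_rw [card_shiftSet, card_halfOpenRect]
    rw [Finset.sum_const, nsmul_eq_mul]
    push_cast
    rfl
  rw [hcard, card_halfOpenBox, hρ', vonNeumannEntropy_fermionPartialTrace_torusBoxEmb L hρ.1] at key
  push_cast at key
  exact key

end TorusBoxes

/-! ### §4 The finite-volume entropy row of the canonical Gibbs state -/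

section Row

variable (L : ℕ) [NeZero L]

/-- **Finite-volume entropy row of the canonical sector Gibbs state.** For `0 ≤ n ≤ 2`, `β > 0`, a rectangle
`B = ∏_i [0,m_i)` with `0 < m_i ≤ L`, and a Hermitian witness `G ∈ 𝔄_B`:
`β·(E_β(L) − E₀(L)) ≤ N_L · (Σ_i p_{L,i} Re torusAvgExpectAt L B G ψ_{L,i} + log Re Tr e^{−G}) + (L² − N_L·∏m_i)·log 4`,
where `E_β(L) = Σ_i p_{L,i} Re⟨ψ_{L,i}, H_L ψ_{L,i}⟩` is the canonical energy, `E₀(L) = E₀(H_L; rectN n L)` the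
ground-state energy and `N_L = ∏⌊L/m_i⌋` (`F = E − TS ≤ E₀`, box subadditivity for the even TI density
`ρ_{L,β}`, Klein with the witness `G` on the box, translation invariance). Dividing by `βL²` and letting
`L → ∞` gives the «ent» row `e − (⟨G⟩ + log Tr e^{−G})/(β|B|) ≤ e₀` of the thermal certificates.
[cite: Israel1979, Lemma II.3.1] [cite: ArakiMoriya2003, Theorem 3.8 and §10] -/
theorem sectorGibbs_energy_sub_groundEnergy_le_box (t t' U : ℝ) {n : ℝ} (hn0 : 0 ≤ n) (hn2 : n ≤ 2)
    {β : ℝ} (hβ : 0 < β) {m : Fin 2 → ℕ} (hmL : ∀ i, m i ≤ L)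
    {G : FermionOp (halfOpenRect m)} (hG : G.IsHermitian) :
    β * (∑ i, sectorGibbsWeightTT' β t t' U n L i *
          (expect (hubbardTorusTT' L t t' U) (sectorGibbsVectorTT' t t' U n L i)).re -
        groundEnergy (hubbardTorusTT' L t t' U) (rectN n L)) ≤
      (#(rectTilingVecs m L) : ℝ) *
          (∑ i, sectorGibbsWeightTT' β t t' U n L i *
              (torusAvgExpectAt L (halfOpenRect m) G (sectorGibbsVectorTT' t t' U n L i)).re +
            Real.log (partitionFn 1 G).re) +
        ((L : ℝ) ^ 2 - (#(rectTilingVecs m L) : ℝ) * (∏ i, (m i : ℝ))) * Real.log 4 := by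
  set ρ := sectorGibbsDensityTT' L β t t' U n with hρ
  have hρpsd : ρ.PosSemidef := posSemidef_sectorGibbsDensityTT' L β t t' U n
  have hρtr : ρ.trace = 1 := trace_sectorGibbsDensityTT' L β t t' U hn0 hn2
  -- thermodynamics: `β (E − E₀) ≤ S(ρ)`
  have h1 := mul_sub_groundEnergy_le_vonNeumannEntropy_sectorGibbsDensityTT' L t t' U hn0 hn2 hβ.le
  rw [re_trace_sectorGibbsDensityTT'_mul] at h1
  -- box subadditivity
  have h2 := torus_vonNeumannEntropy_le_card_mul_box L hρpsd hρtr (parityAut_sectorGibbsDensityTT' L β t t' U n)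
    (relabel_translate_sectorGibbsDensityTT' L β t t' U n) hmL
  -- Klein on the box, with the witness expectation as a torus average
  have h3 := vonNeumannEntropy_fermionPartialTrace_le_re_trace_mul_add
    (PolySite.toTorusEmb L (injOn_proj_halfOpenRect L hmL)) hρpsd hρtr hG
  rw [re_trace_fermionEmbed_toTorusEmb_mul_sectorGibbsDensityTT'] at h3
  have hN : (0 : ℝ) ≤ (#(rectTilingVecs m L) : ℝ) := Nat.cast_nonneg _
  have h4 := mul_le_mul_of_nonneg_left h3 hN
  linarith

end Row

end Literature.MathematicalPhysics.QuantumLattice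

end
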